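/-
Copyright (c) 2026 the pub-hodgecm-mathlib formalisation cell (harness21).  Prover seat hodgecm-mathlib-K2E3-p06 (g4), Track B «K2-LIT», engine E3, unit U4 «Keys»; deal (D61)
LINE LEAD of the open leaf (U4f-χ₁-ram-one), design D-I v2, plan step Z2A-6 «BRANCH A AT DEPTH ZERO, FRAME-FREE» on `U(Φ₃)(L⁺_v)`; 2026-09-04.
KERNEL module: THEOREMS ONLY (no definition, no named fact, no `sorry`, no instance, no notation).
-/
import Summits.HodgeConjecture.HodgeConjecture.Theorems.K2E3BranchAIrreducibleDepthZero      -- ★-filed Z2A-5 (this seat): `false_of_reducible_of_normChar_ne_one` ((G3)-frame + `w₀` + Haar letters); brings every ★ brick of design D-I Branch A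
import HarnessLib

/-!
# K2 ∕ E3 «EllipticInputs», unit U4 «Keys» — (U4f-χ₁-ram-one) step Z2A-6: BRANCH A OF KEYS' THEOREM AT DEPTH ZERO, FRAME-FREE (leaf-shaped)
# «`v` non-split; `χ₁` continuous, non-unitary, contracting, trivial on principal units; `χ₁(u·σu) ≠ 1` for a unit `u ∈ 𝒪ˣ` ⟹ `i(χ₁, 1)` is IRREDUCIBLE»
# [Keys1984 §3, §7 Thm (2); Casselman1995 §6.4; MoyPrasad1996 §3]

Cell hodgecm-mathlib (D-0151), FLOOR 0, Track B «K2-LIT», engine E3, crux item H413 = stmt-HodgeConjecture-24833 (route `HCCMUnconditional`, no route verbs); target BY NAME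
the OPEN leaf `…K2E3EllipticInputs.U4Keys.sig_K2E3KeysThmTwoContractingRamifiedCharOne` (U4Keys ED. 7), design D-I v2, Branch A at depth zero.  Author K2E3-p06 (g4), line lead (D61).
`--supports stmt-HodgeConjecture-24833 --as helper`; THEOREMS ONLY.  NOT THE PAYER: the leaf also needs Branch B (Keys (b)–(d), steps Z2–Z4) and positive depth.

THE POINT.  ★ Z2A-5 `false_of_reducible_of_normChar_ne_one` is stated in the (G3)-EXPLICIT frame `(w hw eA heA ϖ hϖ g₁ hg₁ K₀ K₁ I hK₀ hK₁ hI)` with the letters `w₀` (matrix `Φ₃`) and a Haar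
measure on `N(L⁺_v)`.  THIS FILE discharges the frame at every non-split `v` (a place `w ∣ v`, a uniformiser, `g₁ = diag(1,1,ϖ)`, `eA =` ★ `localNonsplitEquiv` on `Φ₃` — the pattern of
★ `K2E3KeysThmTwoContractingRamified` §3), takes `w₀ = eA⁻¹(w)` (its matrix is `Φ₃`, ★ `coe_eA_apply`, ★ `StdForm.over_map`) and the Haar measure of the closed subgroup `N` (Borel
σ-algebra), and states BRANCH A AT DEPTH ZERO in the letters of the leaf: `¬ ∃ N, N ≠ ⊥ ∧ N ≠ ⊤`.
* **`not_reducible_of_depthZero_of_normChar_ne_one`**.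
HONEST LABEL: HC_CM is proved only modulo the 7 printed citations (2 remaining named inputs: hLiu418 = stmt-HodgeConjecture-24832, h413 = stmt-HodgeConjecture-24833)
until rung 0 closes; count-neutral — this file does NOT pay the leaf; no printed citation is discharged.

## References
* [Keys1984] D. Keys, Compositio Math. 51 (1984), §3, §7 Thm (2).
* [Casselman1995] W. Casselman, *Introduction to the theory of admissible representations of `p`-adic reductive groups* (1995), §6.4.
* [MoyPrasad1996] A. Moy, G. Prasad, Comment. Math. Helv. 71 (1996), §3.
-/

set_option autoImplicit false
-- the mandated namespace has the single-problem summit's repeated segment (`HodgeConjecture.HodgeConjecture`)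
set_option linter.dupNamespace false

noncomputable section

open NumberField IsDedekindDomain MeasureTheory
open scoped Matrix MatrixGroups WithZero Valued
open Literature.NumberTheory Literature.NumberTheory.Automorphic Literature.NumberTheory.Automorphic.UnitaryGroup
open Literature.NumberTheory.Rogawski1990

namespace Summit.HodgeConjecture.HodgeConjecture.Cruxes.H413.K2E3BranchAIrreducibleDepthZeroLeaf

open Summit.HodgeConjecture.HodgeConjecture.Cruxes.H413
open Summit.HodgeConjecture.HodgeConjecture.Cruxes.H413.K2E3DepthZeroIwahoriCharacterCM
open Summit.HodgeConjecture.HodgeConjecture.Cruxes.H413.K2E3BranchAIrreducibleDepthZero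

variable (L : Type) [Field L] [NumberField L] [IsCMField L] (v : HeightOneSpectrum (𝓞 ↥(maximalRealSubfield L)))

set_option maxHeartbeats 8000000 in
set_option synthInstance.maxHeartbeats 400000 in
-- ★ Z2A-5 instantiated: the frame, `w₀ = eA⁻¹(w)`, the Haar measure of `N` (class of ★ `K2E3KeysThmTwoContractingRamified` §3)
/-- **BRANCH A OF KEYS' THEOREM AT DEPTH ZERO, frame-free.**  `v` non-split; `χ₁ : (L ⊗ L⁺_v)ˣ → ℂˣ` continuous, non-unitary (`∃ x, |χ₁ x| ≠ 1`), contracting, trivial on the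
principal units `{u : |u_{w′} − 1| < 1}` (depth zero); `u` a unit with `|u_{w′}| = 1` and `χ₁(u · σu) ≠ 1` (`χ₁ ∘ N ≠ 1` on `𝒪ˣ`: Branch A, `w₀ ∉ W_χ`).  Then the principal
series `i(χ₁, 1)` of `U(Φ₃)(L⁺_v)` has no `G`-stable subspace other than `⊥`, `⊤` (★ Z2A-5 with the frame of ★ p857330 §3, `w₀ = eA⁻¹(w)`, Haar measure on `N`).
[cite: Keys1984, §3, §7 Thm (2)] [cite: Casselman1995, §6.4] [cite: MoyPrasad1996, §3] -/
theorem not_reducible_of_depthZero_of_normChar_ne_one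
    (hns : ∀ w' : PlacesOver L v, IsCMField.complexConj L • w'.1 = w'.1)
    (χ₁ : (LocalRing L v)ˣ →* ℂˣ) (h₁ : Continuous fun x => ((χ₁ x : ℂˣ) : ℂ)) (hnu : ∃ x, ‖((χ₁ x : ℂˣ) : ℂ)‖ ≠ 1)
    (hcontr : ∀ x : (LocalRing L v)ˣ, unitModulusChar (LocalRing L v) x < 1 → ‖((χ₁ x : ℂˣ) : ℂ)‖ < 1)
    (hdepth : ∀ u : (LocalRing L v)ˣ, (∀ w' : PlacesOver L v, Valued.v (((u : LocalRing L v) w') - 1) < 1) → χ₁ u = 1)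
    (u : (LocalRing L v)ˣ) (hu : ∀ w' : PlacesOver L v, Valued.v ((u : LocalRing L v) w') = 1)
    (hA : χ₁ (u * Units.map (conjLocal L (IsCMField.complexConj L) v : LocalRing L v →* LocalRing L v) u) ≠ 1) :
    ¬ ∃ N : Subrepresentation (cmPrincipalSeries L 3 v (cmTorusCharPair L v χ₁ 1)), N ≠ ⊥ ∧ N ≠ ⊤ := by
  classical
  intro hred
  obtain ⟨w⟩ : Nonempty (PlacesOver L v) := inferInstance
  have hw : IsCMField.complexConj L • w.1 = w.1 := hns w
  -- the (G3)-EXPLICIT letters (★ p857330 §3 pattern): a uniformiser, `g₁ = diag(1,1,ϖ)`, `eA =` ★ `localNonsplitEquiv` on `Φ₃`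
  obtain ⟨ϖ, hϖ⟩ : ∃ τ : w.1.adicCompletion L, Valued.v τ = WithZero.exp (-1 : ℤ) := by
    obtain ⟨π, hπ⟩ := w.1.valuation_exists_uniformizer L
    exact ⟨(π : w.1.adicCompletion L), by rw [HeightOneSpectrum.valuedAdicCompletion_eq_valuation', hπ]⟩
  have hϖ0 : ϖ ≠ 0 := fun h0 => by rw [h0, map_zero] at hϖ; exact WithZero.zero_ne_coe hϖ
  obtain ⟨g₁, hg₁⟩ : ∃ g₁ : GL (Fin 3) (w.1.adicCompletion L), (g₁ : Matrix (Fin 3) (Fin 3) (w.1.adicCompletion L)) = Matrix.diagonal ![(1 : w.1.adicCompletion L), 1, ϖ] := by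
    refine ⟨glDiagonal 3 (w.1.adicCompletion L) ![1, 1, Units.mk0 ϖ hϖ0], ?_⟩
    rw [coe_glDiagonal]
    congr 1
    funext i
    fin_cases i <;> rfl
  have hJw : placeForm (qsForm L) w.1 = (StdForm.antidiagonal 3).over (w.1.adicCompletion L) := by
    rw [placeForm, qsForm, antidiagOne_eq_over, StdForm.over_map]
  obtain ⟨eA, heA⟩ : ∃ eA : Gqs L v ≃ₜ* ↥(unitaryGroupOfForm (galAdicCompletionMap (L := L) (IsCMField.complexConj L) hw) ((StdForm.antidiagonal 3).over (w.1.adicCompletion L))),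
      ∀ g : Gqs L v, ((eA g : ↥(unitaryGroupOfForm (galAdicCompletionMap (L := L) (IsCMField.complexConj L) hw) ((StdForm.antidiagonal 3).over (w.1.adicCompletion L)))) :
          GL (Fin 3) (w.1.adicCompletion L)) =
        ((localNonsplitEquiv (IsCMField.complexConj L) (qsForm L) (IsCMField.complexConj_ne_one L) w hw g :
          ↥(unitaryGroupOfForm (galAdicCompletionMap (L := L) (IsCMField.complexConj L) hw) (placeForm (qsForm L) w.1))) : GL (Fin 3) (w.1.adicCompletion L)) := by
    rw [← hJw]
    exact ⟨localNonsplitEquiv (IsCMField.complexConj L) (qsForm L) (IsCMField.complexConj_ne_one L) w hw, fun g => rfl⟩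
  -- `w₀ = eA⁻¹(w)` has matrix `Φ₃`
  have hw₀ : Units.val ((eA.symm (weylLongU (galAdicCompletionMap (L := L) (IsCMField.complexConj L) hw)
      (rfl : (StdForm.antidiagonal 3).over (w.1.adicCompletion L) = _))).val : GL (Fin 3) (LocalRing L v)) = cmLocalForm L 3 v := by
    refine Matrix.ext fun i j => ?_
    rw [LocalRing.eq_iff_apply_eq (IsCMField.complexConj L) (IsCMField.complexConj_ne_one L) w hw,
      ← coe_eA_apply L v w hw eA heA (eA.symm (weylLongU (galAdicCompletionMap (L := L) (IsCMField.complexConj L) hw) rfl)) i j,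
      ContinuousMulEquiv.apply_symm_apply, coe_coe_weylLongU, cmLocalForm_eq_over]
    have h := congr_fun (congr_fun ((StdForm.antidiagonal 3).over_map (Pi.evalRingHom (fun w' : PlacesOver L v => w'.1.adicCompletion L) w)) i) j
    rw [Matrix.map_apply, Pi.evalRingHom_apply] at h
    exact h.symm
  -- the Haar measure of the closed subgroup `N(L⁺_v)`
  letI : MeasurableSpace ↥(cmBorelTriple L 3 v).N := borel _
  haveI : BorelSpace ↥(cmBorelTriple L 3 v).N := ⟨rfl⟩
  haveI : LocallyCompactSpace ↥(unitaryGroupOfForm (conjLocal L (IsCMField.complexConj L) v) (cmLocalForm L 3 v)) :=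
    locallyCompactSpace_local (IsCMField.complexConj L) 3 _ v
  haveI : LocallyCompactSpace ↥(cmBorelTriple L 3 v).N :=
    (LineRing.isClosed_unipotentU (conjLocal L (IsCMField.complexConj L) v) (cmLocalForm L 3 v)).isClosedEmbedding_subtypeVal.locallyCompactSpace
  exact false_of_reducible_of_normChar_ne_one L v w hw eA heA hϖ g₁ hg₁ _ _ _ rfl rfl rfl hns χ₁ h₁ hnu hcontr hdepth u hu hA
    (eA.symm (weylLongU (galAdicCompletionMap (L := L) (IsCMField.complexConj L) hw) (rfl : (StdForm.antidiagonal 3).over (w.1.adicCompletion L) = _)))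
    hw₀ Measure.haar hred

end Summit.HodgeConjecture.HodgeConjecture.Cruxes.H413.K2E3BranchAIrreducibleDepthZeroLeaf

end
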